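import Summits.CriticalPhenomena.CardyFormulaZ2.Theorems.CardyIKTransportIKLinearTransportFarRSWFragments

/-!
# `CardyIKTransport.IKLinearTransport` (stmt-CriticalPhenomena-5076), line `pinned-diagram-exchange`, skeleton v24 stub
# `stub_IKFarRSW` — THE BOX-CROSSING CLAUSES AT EVERY ASPECT RATIO (lead c7)

Support file (`--supports stmt-CriticalPhenomena-5076`; registered sub-goals `ikFarRSW_tbCross_all`,
`ikFarRSW_lrCross_all_iso`, `ikFarRSW_cross_all_hon`).

`stub_IKFarRSW` (= the proposed route child `IKFarRSW`) asks, for every aspect bound `k`, every column pattern `S` and every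
`w × h` box with `n ≤ w, h ≤ k n`: a black left–right crossing, a black bottom–top crossing and a black ring, each with
`ν_S`-probability `≥ c_k`.  Seat c6 imported the sister line's (crux `IKMixedBoxCrossing`, stmt-5911) LANDED monotone
Yang–Baxter cylinder transport (`…IKMixedBoxCrossingTransportVerticalClause`, p138511) at aspect `2` only, because its final
assembly `verticalClause` is stated for `n × 2n` boxes.  OBSERVATION OF THIS FILE: nothing in that transport is tied to aspect `2`.
The 1D link inequality `LastColLinkMono`, hence `ArcsIsoGeHon` (isotropic ≥ honeycomb for the cylinder-arcs probability), the
bunching `CylBunching` and the cylinder-versus-plane helpers (`CylPlane.arcsEvent_subset`, `CylPlane.cylProb_bandQ_le`,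
`CylPlane.band0_subset_tb`, `CylPlane.qProb_TBQ_eq`) hold for EVERY slab width; only `stub_cylPlane` and `stub_triCylArcs` fixed the
width to `n - 1`, resp. `(n-1)/2`.  Shrinking the slab to `(n-1)/K` face columns (§1–§2) makes the honeycomb input a site-`𝕋`
crossing of aspect `≍ 16K` (tree RSW, `pow_mul_pow_le_triLRCrossingProb_of_le`) and the output the bottom–top crossing of the
`((n-1)/K + 1) × 2n` box for EVERY pattern (§3); height antitonicity and width monotonicity then give

* `verticalClause_aspect` (§4): for every `k` there is `c_k > 0` with `P_S[BT(w × h)] ≥ c_k` for all `S`, all positions and all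
  boxes with `1 ≤ w`, `1 ≤ h ≤ k w` — the bottom–top clause of `IKFarRSW` at every aspect bound, uniformly in the pattern
  (`ikFarRSW_tbCross_all`, §7);
* by the quarter turn of the isotropic gauge and free/pattern locality (§5–§6): BOTH clauses at every aspect for every box whose
  interior face columns are isotropic (`horizontalClause_aspect_iso`, `ikFarRSW_lrCross_all_iso`) or whose columns are honeycomb
  (`crossings_aspect_hon`, `ikFarRSW_cross_all_hon`); in particular `pureIK_boxCrossing_allAspects`: the isotropic
  Izergin–Korepin cell model (corner fugacity `√3/2`, fair saddle coins — no positive association, Disproof §4 of stmt-5911) has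
  the box-crossing property at ALL aspect ratios.

What remains of `IKFarRSW` after this file: the left–right clause of MIXED boxes (= stmt-5911's `HorizontalClause`) and the RINGS
(a black circuit needs four simultaneous long crossings of overlapping strips: the FKG-free gluing residue proper; the `S = ∅` ring
clause is classical and rides separately).
-/

noncomputable section

namespace Summit.CriticalPhenomena.CardyFormulaZ2.Theorems.IKLinearTransport.PinnedDiagramExchange.FarRSWAllAspects

open Summit.CriticalPhenomena.CardyFormulaZ2.Theorems.IKLinearTransport.PinnedDiagramExchange
open Summit.CriticalPhenomena.CardyFormulaZ2.Cruxes.IKMixedBoxCrossing.PairedMirrorExploration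
open Summit.CriticalPhenomena.CardyFormulaZ2.Cruxes.IKMixedBoxCrossing.DefectClosureExploration
open Summit.CriticalPhenomena.CardyFormulaZ2.Cruxes.IKMixedBoxCrossing.PairedMirrorExploration.StubPatternLocality (recentre)
open MeasureTheory Literature.Probability.Percolation Literature.Probability.LatticeModels

/-! ## §1 Cylinder versus plane at every slab width -/

open CylPlane in
/-- **CYLINDER ↔ PLANE AT EVERY SLAB WIDTH** (the sister line's `stub_cylPlane` with the width freed): for the slab of `w` face
columns on the cylinder of circumference `8n`, `2w + 1 ≤ 6n`, the arcs probability is at most `4 · P_S[BT((w+1) × 2n)]` — the two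
rotated bands (`arcsEvent_subset`, rotation invariance), the cut with the `L∞` mixing of the row kernel (`cylProb_bandQ_le`, factor
`2`, needs `2w + 1 ≤ 6n` off-band rows), and the gauge bridge at the origin recentred by pattern locality (`qProb_TBQ_eq`, `recentre`). -/
theorem cylPlane_width (S : Set ℤ) (n : ℕ) (a b : ℤ) (w L : ℕ) [NeZero L] (hn : 1 ≤ n) (hL : L = 8 * n)
    (hw : 2 * w + 1 ≤ 6 * n) : cylArcs w L (τOf S a w) n ≤ 4 * pTB S a b (w + 1) (2 * n) := by
  obtain ⟨m, rfl⟩ : ∃ m, n = m + 1 := ⟨n - 1, by omega⟩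
  set τ := τOf S a w with hτdef
  have hτ : ∀ j : Fin w, τ j = true ↔ ((j : ℕ) : ℤ) ∈ {x : ℤ | x + a ∈ S} := fun j => by
    simp only [hτdef, τOf, decide_eq_true_eq, Set.mem_setOf_eq, add_comm]
  have h1 := (cylProb_mono' τ (arcsEvent_subset (w := w) hn hL)).trans (cylProb_union_le τ _ _)
  rw [cylProb_preimage_rot, cylProb_preimage_rot] at h1
  have h2 : cylProb w L τ (Band0 w L (2 * (m + 1))) ≤
      cylProb w L τ ((bandQ L (2 * m + 1) : CylCfg w L → Q w (2 * m + 1)) ⁻¹' TBQ w (2 * m + 1)) :=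
    cylProb_mono' τ (by rw [show 2 * (m + 1) = (2 * m + 1) + 1 by ring]; exact band0_subset_tb (by omega))
  have h3 := cylProb_bandQ_le (w := w) (L := L) (h := 2 * m + 1) (d' := 6 * m + 6) (by omega) (by omega) τ
    (TBQ w (2 * m + 1))
  have h4 : qProb τ (TBQ w (2 * m + 1)) = pTB S a b (w + 1) (2 * (m + 1)) := by
    rw [(recentre S a b (w + 1) (2 * (m + 1))).2, show 2 * (m + 1) = (2 * m + 1) + 1 by ring]
    exact qProb_TBQ_eq {x : ℤ | x + a ∈ S} τ hτ
  unfold cylArcs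
  linarith

/-! ## §2 Triangular cylinder arcs at every aspect -/

/-- **RSW input at aspect `K`.** A constant `c_K > 0` below `P(H₁) P(H₂) P(V)` for every `n ≥ 1` at slab width
`w = (n-1)/(2K)`: the two horizontal crossings of the `(w+1) × n` boxes are easy-direction crossings (width antitonicity and
`exists_rsw_const`); the vertical crossing of the `(w+1) × 4n` box is a long-way crossing of aspect `≤ 16K + 1` when `w ≥ 1`
(RSW chaining `pow_mul_pow_le_triLRCrossingProb_of_le`), and for `w = 0` (i.e. `n ≤ 2K`) a fixed positive number
(`triLRCrossingProb_pos`, width antitonicity). -/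
theorem exists_const_le_prod_aspect (K : ℕ) (hK : 1 ≤ K) : ∃ c : ℝ, 0 < c ∧ ∀ n : ℕ, 1 ≤ n →
    c ≤ (sitePercolation (Site 2) half).real (triHCross 0 (2 * n) ((n - 1) / (2 * K)) (n - 1)) *
        (sitePercolation (Site 2) half).real (triHCross 0 (5 * n) ((n - 1) / (2 * K)) (n - 1)) *
        (sitePercolation (Site 2) half).real (triVCross 0 (2 * n) ((n - 1) / (2 * K)) (4 * n - 1)) := by
  obtain ⟨c₀, hc₀, hk⟩ := HoneycombStub.exists_rsw_const
  have hhalf : 0 < ((half : unitInterval) : ℝ) := by simp [half]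
  set cV : ℝ := min (c₀ ^ (16 * K) * c₀ ^ (16 * K - 1)) (triLRCrossingProb half (8 * K + 3) 0) with hcV
  have hcVpos : 0 < cV := lt_min (by positivity) (triLRCrossingProb_pos hhalf _ _)
  refine ⟨c₀ * c₀ * cV, by positivity, fun n hn => ?_⟩
  set w := (n - 1) / (2 * K) with hw
  have eH : ∀ b : ℤ, (sitePercolation (Site 2) half).real (triHCross 0 b w (n - 1)) =
      triLRCrossingProb half w (n - 1) := fun b => triSitePercolation_real_triHCross half 0 b _ _
  have eV : (sitePercolation (Site 2) half).real (triVCross 0 (2 * n) w (4 * n - 1)) =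
      triLRCrossingProb half (4 * n - 1) w := triSitePercolation_real_triVCross half 0 _ _ _
  rw [eH, eH, eV]
  have hwle : w ≤ n - 1 := Nat.div_le_self _ _
  have hH : c₀ ≤ triLRCrossingProb half w (n - 1) :=
    (hk (n - 1)).trans (triLRCrossingProb_anti_width half (by omega) (n - 1))
  have hlt : n - 1 < w * (2 * K) + 2 * K := Nat.lt_div_mul_add (by omega)
  have hV : cV ≤ triLRCrossingProb half (4 * n - 1) w := by
    rcases Nat.eq_zero_or_pos w with hw0 | hw0
    · rw [hw0] at hlt ⊢
      exact (min_le_right _ _).trans (triLRCrossingProb_anti_width half (by omega) 0)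
    · refine (min_le_left _ _).trans ?_
      have h₁ : c₀ ≤ triLRCrossingProb half (2 * w) w :=
        (hk w).trans (triLRCrossingProb_anti_width half (by omega) _)
      have h₂ : c₀ ≤ triLRCrossingProb half w w :=
        (hk w).trans (triLRCrossingProb_anti_width half (by omega) _)
      have hP : 2 * K ≤ w * (2 * K) := Nat.le_mul_of_pos_left _ hw0
      have hbound : 4 * n - 1 ≤ (16 * K + 1) * w := by
        have e : (16 * K + 1) * w = 8 * (w * (2 * K)) + w := by ring
        rw [e]
        omega
      have := pow_mul_pow_le_triLRCrossingProb_of_le half w hc₀.le hc₀.le h₁ h₂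
        (j := 16 * K) (by omega) (w := 4 * n - 1) hbound
      simpa using this
  have h0 : 0 ≤ triLRCrossingProb half w (n - 1) := measureReal_nonneg
  calc c₀ * c₀ * cV ≤ triLRCrossingProb half w (n - 1) * triLRCrossingProb half w (n - 1)
        * triLRCrossingProb half (4 * n - 1) w :=
        mul_le_mul (mul_le_mul hH hH hc₀.le h0) hV hcVpos.le (mul_nonneg h0 h0)
    _ = _ := by ring

/-- **TRIANGULAR CYLINDER ARCS AT ASPECT `K`**: for the all-honeycomb slab of `(n-1)/(2K)` face columns on the cylinder of
circumference `8n`, the two antipodal arcs of the left column are black-joined inside the slab with probability `≥ c_K > 0`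
uniformly in `n ≥ 1` (the sister line's `prod_le_cylArcs` — Harris + the gluing `honCfg_mem_arcsEvent`, valid at every width —
and `exists_const_le_prod_aspect`). -/
theorem triCylArcs_aspect (K : ℕ) (hK : 1 ≤ K) : ∃ c : ℝ, 0 < c ∧ ∀ (n L : ℕ) [NeZero L], 1 ≤ n → L = 8 * n →
    c ≤ cylArcs ((n - 1) / (2 * K)) L (fun _ => false) n := by
  obtain ⟨c, hc, h⟩ := exists_const_le_prod_aspect K hK
  refine ⟨c, hc, fun n L _ hn hL => ?_⟩
  subst hL
  exact (h n hn).trans (TriCylArcsProof.prod_le_cylArcs hn _)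

/-! ## §3 The vertical floor at aspect `K`, every pattern -/

/-- **THE VERTICAL FLOOR AT ASPECT `K` FOR EVERY PATTERN**: `P_S[BT(((n-1)/K + 1) × 2n)] ≥ c_K / 4` for every `S`, `n ≥ 1`
and position — `triCylArcs_aspect` at width `(n-1)/(2K)`, isotropic ≥ honeycomb (`ArcsIsoGeHon` from the landed
`LastColLinkMono`), bunching to the slab of `(n-1)/K` face columns with the pattern's types (`CylBunching`), and
`cylPlane_width`. -/
theorem verticalFloor_aspect (K : ℕ) (hK : 1 ≤ K) :
    ∃ c : ℝ, 0 < c ∧ ∀ (S : Set ℤ) (n : ℕ) (a b : ℤ), 1 ≤ n → c ≤ pTB S a b ((n - 1) / K + 1) (2 * n) := by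
  obtain ⟨ct, hct, ht⟩ := triCylArcs_aspect K hK
  have hIso : ArcsIsoGeHon :=
    stub_arcsIsoGeHon_of stub_cylExchange stub_slabDeterminacy (stub_lastFaceMono_of stub_lastColLinkMono)
  have hB : CylBunching := stub_cylBunch stub_cylExchange stub_slabDeterminacy
  refine ⟨ct / 4, by positivity, fun S n a b hn => ?_⟩
  haveI : NeZero (8 * n) := ⟨by omega⟩
  have h8 : 3 ≤ 8 * n := by omega
  have hw2 : (n - 1) / K / 2 = (n - 1) / (2 * K) := by rw [Nat.div_div_eq_div_mul, mul_comm]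
  have hwle : (n - 1) / K ≤ n - 1 := Nat.div_le_self _ _
  have hplane := cylPlane_width S n a b ((n - 1) / K) (8 * n) hn rfl (by omega)
  have hbunch := hB ((n - 1) / K) (8 * n) n h8 (τOf S a ((n - 1) / K))
  have htri := ht n (8 * n) hn rfl
  have hiso := hIso ((n - 1) / (2 * K)) (8 * n) n h8
  rw [hw2] at hbunch
  have hmin : ct ≤ min (cylArcs ((n - 1) / (2 * K)) (8 * n) (fun _ => false) n)
      (cylArcs ((n - 1) / (2 * K)) (8 * n) (fun _ => true) n) := le_min htri (htri.trans hiso)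
  linarith [hmin.trans hbunch]

/-! ## §4 The bottom–top clause at every aspect bound, every pattern -/

/-- **THE BOTTOM–TOP CLAUSE AT EVERY ASPECT BOUND, EVERY PATTERN**: for every `k` there is `c > 0` such that for every column
pattern `S`, every position and every `w × h` box with `1 ≤ w` and `1 ≤ h ≤ k w`, the box is crossed bottom-to-top by a black path
with probability at least `c` — the floor `verticalFloor_aspect (k+1)` at the reference scale `n = k+1` (if `h ≤ 2(k+1)`) or
`n = ⌈h/2⌉` (otherwise; then `(n-1)/(k+1) + 1 ≤ w` because `h ≤ k w`), antitonicity in the height (`stub_monotone`) and monotonicity in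
the width (`FarRSWFragments.tbCross_subset_of_width_le`).  No positive association is used anywhere. -/
theorem verticalClause_aspect (k : ℕ) : ∃ c : ℝ, 0 < c ∧ ∀ (S : Set ℤ) (a b : ℤ) (w h : ℕ),
    1 ≤ w → 1 ≤ h → h ≤ k * w → c ≤ pTB S a b w h := by
  obtain ⟨c, hc, hfl⟩ := verticalFloor_aspect (k + 1) (by omega)
  refine ⟨c, hc, fun S a b w h hw hh hk => ?_⟩
  haveI := CouplingToLimits.isProbabilityMeasure_μIK
  obtain ⟨n, hn, hWn, hhn⟩ : ∃ n : ℕ, 1 ≤ n ∧ (n - 1) / (k + 1) + 1 ≤ w ∧ h ≤ 2 * n := by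
    by_cases hsmall : h ≤ 2 * (k + 1)
    · refine ⟨k + 1, by omega, ?_, hsmall⟩
      rw [Nat.add_sub_cancel, Nat.div_eq_of_lt (Nat.lt_succ_self k)]
      omega
    · refine ⟨(h + 1) / 2, by omega, ?_, by omega⟩
      have hkw : w * (k + 1) = k * w + w := by ring
      have hlt : (h + 1) / 2 - 1 < w * (k + 1) := by rw [hkw]; omega
      have := (Nat.div_lt_iff_lt_mul (by omega : 0 < k + 1)).2 hlt
      omega
  have e1 : c ≤ pTB S a b ((n - 1) / (k + 1) + 1) (2 * n) := hfl S n a b hn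
  have e2 : pTB S a b ((n - 1) / (k + 1) + 1) (2 * n) ≤ pTB S a b ((n - 1) / (k + 1) + 1) h :=
    stub_monotone.2 S a b _ h (2 * n) hh hhn
  have e3 : pTB S a b ((n - 1) / (k + 1) + 1) h ≤ pTB S a b w h :=
    measureReal_mono (Set.preimage_mono (FarRSWFragments.tbCross_subset_of_width_le hWn))
  linarith

/-! ## §5 Locality: isotropic-interior boxes read the isotropic model, honeycomb boxes the triangular one -/

/-- ISOTROPIC-INTERIOR BOXES READ THE ISOTROPIC MODEL: if every interior face column `x` of the `w × h` box at `(a, b)`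
(`a ≤ x`, `x + 1 < a + w`) is an `S`-column, then `pLR S a b w h = pLR univ 0 0 w h` and `pTB S a b w h = pTB univ 0 0 w h`
(recentring `recentre`, the gauge bridge at the origin `origin_bridge`, and free locality `stub_freeLocality`). -/
theorem pLR_pTB_eq_univ_of_iso (S : Set ℤ) (a b : ℤ) (w h : ℕ) (hS : ∀ x : ℤ, a ≤ x → x + 1 < a + w → x ∈ S) :
    pLR S a b w h = pLR Set.univ 0 0 w h ∧ pTB S a b w h = pTB Set.univ 0 0 w h := by
  have hS' : ∀ x : ℤ, 0 ≤ x → x + 1 < 0 + (w : ℤ) → x ∈ {z : ℤ | z + a ∈ S} := fun x h0 h1 =>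
    hS (x + a) (by omega) (by omega)
  obtain ⟨hl, ht⟩ := recentre S a b w h
  obtain ⟨fl, ft⟩ := stub_freeLocality {z : ℤ | z + a ∈ S} 0 0 w h hS'
  obtain ⟨ol, ot⟩ := BridgeOfLawStub.origin_bridge stub_bridgeLaw {z : ℤ | z + a ∈ S} w h
  obtain ⟨ul, ut⟩ := BridgeOfLawStub.origin_bridge stub_bridgeLaw Set.univ w h
  exact ⟨by rw [hl, ol, fl, ← ul], by rw [ht, ot, ft, ← ut]⟩

/-- THE TRANSPOSE SYMMETRY OF THE TRIANGULAR MEMBER: `P_∅[LR(w × h)] = P_∅[BT(h × w)]` for `w ≥ 2`, `h ≥ 1` (both are the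
site-`𝕋` parallelogram crossing probability `triLRCrossingProb half (w-1) (h-1)`: `pLR_empty`, `pTB_empty`). -/
theorem pLR_empty_eq_pTB_empty (a b : ℤ) (w h : ℕ) (hw : 2 ≤ w) (hh : 1 ≤ h) :
    pLR ∅ a b w h = pTB ∅ a b h w := by
  obtain ⟨m, rfl⟩ : ∃ m, w = m + 2 := ⟨w - 2, by omega⟩
  obtain ⟨k, rfl⟩ : ∃ k, h = k + 1 := ⟨h - 1, by omega⟩
  rw [HoneycombStub.pLR_empty, HoneycombStub.pTB_empty]

/-! ## §6 Both clauses at every aspect on isotropic and on honeycomb boxes -/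

/-- **THE LEFT–RIGHT CLAUSE AT EVERY ASPECT ON ISOTROPIC-INTERIOR BOXES, EVERY PATTERN**: for every `k` there is `c > 0` such
that every `w × h` box with `1 ≤ w ≤ k h`, `1 ≤ h`, whose interior face columns are isotropic, is crossed left-to-right by a black
path with `P_S`-probability `≥ c` — locality to the isotropic model (`pLR_pTB_eq_univ_of_iso`), the quarter turn
(`stub_quarterTurn`, `univ_recentre`) and `verticalClause_aspect` at `S = univ`. -/
theorem horizontalClause_aspect_iso (k : ℕ) : ∃ c : ℝ, 0 < c ∧ ∀ (S : Set ℤ) (a b : ℤ) (w h : ℕ),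
    1 ≤ w → 1 ≤ h → w ≤ k * h → (∀ x : ℤ, a ≤ x → x + 1 < a + w → x ∈ S) → c ≤ pLR S a b w h := by
  obtain ⟨c, hc, hv⟩ := verticalClause_aspect k
  refine ⟨c, hc, fun S a b w h hw hh hk hS => ?_⟩
  rw [(pLR_pTB_eq_univ_of_iso S a b w h hS).1, ← (univ_recentre stub_patternLocality (1 - (w : ℤ)) 0 w h).1,
    ← stub_quarterTurn h w]
  exact hv Set.univ 0 0 h w hh hw hk

/-- **RSW FOR THE ISOTROPIC IZERGIN–KOREPIN MODEL AT EVERY ASPECT RATIO**: for every `k` there is `c > 0` such that every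
`w × h` box with `1 ≤ w ≤ k h` and `1 ≤ h ≤ k w` is crossed left-to-right AND bottom-to-top by black paths of the isotropic model
(`S = univ`: corner fugacity `√3/2`, fair saddle coins) with probability at least `c`, at every position.  The model is not
positively associated; the proof is the monotone Yang–Baxter cylinder transport of the sister line at slab width `≍ n/k` plus
site-`𝕋` RSW. -/
theorem pureIK_boxCrossing_allAspects (k : ℕ) : ∃ c : ℝ, 0 < c ∧ ∀ (a b : ℤ) (w h : ℕ),
    1 ≤ w → 1 ≤ h → w ≤ k * h → h ≤ k * w → c ≤ pLR Set.univ a b w h ∧ c ≤ pTB Set.univ a b w h := by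
  obtain ⟨c₁, hc₁, hL⟩ := horizontalClause_aspect_iso k
  obtain ⟨c₂, hc₂, hV⟩ := verticalClause_aspect k
  refine ⟨min c₁ c₂, lt_min hc₁ hc₂, fun a b w h hw hh hwk hhk => ⟨?_, ?_⟩⟩
  · exact (min_le_left _ _).trans (hL Set.univ a b w h hw hh hwk fun _ _ _ => Set.mem_univ _)
  · exact (min_le_right _ _).trans (hV Set.univ a b w h hw hh hhk)

/-- **BOTH CLAUSES AT EVERY ASPECT ON HONEYCOMB BOXES, EVERY PATTERN**: for every `k` there is `c > 0` such that every `w × h`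
box with `1 ≤ w ≤ k h`, `1 ≤ h ≤ k w`, all of whose cell columns are honeycomb (`x ∉ S` for `a ≤ x < a + w`), is crossed
left-to-right and bottom-to-top by black paths with `P_S`-probability `≥ c` — pattern locality to `S = ∅` (`stub_patternLocality`),
the transpose symmetry of the triangular member (`pLR_empty_eq_pTB_empty`; width-`1` boxes through `stub_monotone`) and
`verticalClause_aspect (k+2)` at `S = ∅`. -/
theorem crossings_aspect_hon (k : ℕ) : ∃ c : ℝ, 0 < c ∧ ∀ (S : Set ℤ) (a b : ℤ) (w h : ℕ),
    1 ≤ w → 1 ≤ h → w ≤ k * h → h ≤ k * w → (∀ x : ℤ, a ≤ x → x < a + w → x ∉ S) →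
    c ≤ pLR S a b w h ∧ c ≤ pTB S a b w h := by
  obtain ⟨c, hc, hv⟩ := verticalClause_aspect (k + 2)
  refine ⟨c, hc, fun S a b w h hw hh hwk hhk hS => ?_⟩
  have hpat : ∀ i : ℕ, i < w → (a + i ∈ S ↔ a + i ∈ (∅ : Set ℤ)) := fun i hi =>
    ⟨fun hmem => (hS (a + i) (by omega) (by omega) hmem).elim, fun hmem => hmem.elim⟩
  obtain ⟨hl, ht⟩ := stub_patternLocality S ∅ a a b b w h hpat
  have hkh : w ≤ (k + 2) * h := by nlinarith
  refine ⟨?_, ?_⟩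
  · rw [hl]
    rcases Nat.lt_or_ge w 2 with hw1 | hw2
    · obtain rfl : w = 1 := by omega
      have hmono : pLR ∅ a b 2 h ≤ pLR ∅ a b 1 h := stub_monotone.1 ∅ a b 1 2 h le_rfl (by omega)
      rw [pLR_empty_eq_pTB_empty a b 2 h le_rfl hh] at hmono
      exact (hv ∅ a b h 2 hh (by omega) (by nlinarith)).trans hmono
    · rw [pLR_empty_eq_pTB_empty a b w h hw2 hh]
      exact hv ∅ a b h w hh hw hkh
  · rw [ht]
    exact hv ∅ a b w h hw hh (by nlinarith)

/-! ## §7 In the line's vocabulary: the registered sub-goals of `stub_IKFarRSW` -/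

/-- **Registered sub-goal `ikFarRSW_tbCross_all` — THE FULL BOTTOM–TOP CLAUSE OF `IKFarRSW` (every aspect bound `k`, every
pattern `S`)**: for every `k` there is `c > 0` such that for every `S`, `n ≥ 1`, position and `w × h` box with `n ≤ w ≤ k n`,
`n ≤ h ≤ k n`, the box is crossed bottom-to-top by a black path with `ν_S`-probability at least `c` (`verticalClause_aspect` read
through `nuMix_real_tbCross`; `h ≤ k n ≤ k w`).  This is the second conjunct of `FarRSWBound c S n a b w h univ` for every `k`. -/
theorem ikFarRSW_tbCross_all : ∀ k : ℕ, ∃ c : ℝ, 0 < c ∧ ∀ (S : Set ℤ) (n : ℕ) (a b : ℤ) (w h : ℕ),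
    1 ≤ n → n ≤ w → w ≤ k * n → n ≤ h → h ≤ k * n → c ≤ (νmix S).real (tbCross a b w h) := by
  intro k
  obtain ⟨c, hc, hv⟩ := verticalClause_aspect k
  refine ⟨c, hc, fun S n a b w h hn hnw _ hnh hhk => ?_⟩
  rw [nuMix_real_tbCross]
  exact hv S a b w h (by omega) (by omega) (hhk.trans (Nat.mul_le_mul_left k hnw))

/-- **Registered sub-goal `ikFarRSW_lrCross_all_iso` — THE LEFT–RIGHT CLAUSE OF `IKFarRSW` AT EVERY ASPECT BOUND ON
ISOTROPIC-INTERIOR BOXES (every pattern `S`)**: for every `k` there is `c > 0` such that for every `S`, `n ≥ 1`, position and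
`w × h` box with `n ≤ w ≤ k n`, `n ≤ h ≤ k n` whose interior face columns are isotropic, the box is crossed left-to-right by a black
path with `ν_S`-probability at least `c` (`horizontalClause_aspect_iso` through `nuMix_real_lrCross`).  Supersedes seat c6's
`ikFarRSW_lrCross_le_two_iso`. -/
theorem ikFarRSW_lrCross_all_iso : ∀ k : ℕ, ∃ c : ℝ, 0 < c ∧ ∀ (S : Set ℤ) (n : ℕ) (a b : ℤ) (w h : ℕ),
    1 ≤ n → n ≤ w → w ≤ k * n → n ≤ h → h ≤ k * n → (∀ x : ℤ, a ≤ x → x + 1 < a + w → x ∈ S) →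
    c ≤ (νmix S).real (lrCross a b w h) := by
  intro k
  obtain ⟨c, hc, hl⟩ := horizontalClause_aspect_iso k
  refine ⟨c, hc, fun S n a b w h hn hnw hwk hnh _ hS => ?_⟩
  rw [nuMix_real_lrCross]
  exact hl S a b w h (by omega) (by omega) (hwk.trans (Nat.mul_le_mul_left k hnh)) hS

/-- **Registered sub-goal `ikFarRSW_cross_all_hon` — BOTH CROSSING CLAUSES OF `IKFarRSW` AT EVERY ASPECT BOUND ON HONEYCOMB
BOXES (every pattern `S`)**: for every `k` there is `c > 0` such that for every `S`, `n ≥ 1`, position and `w × h` box with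
`n ≤ w ≤ k n`, `n ≤ h ≤ k n` all of whose cell columns are honeycomb, the box is crossed left-to-right and bottom-to-top by black
paths with `ν_S`-probability at least `c` (`crossings_aspect_hon`). -/
theorem ikFarRSW_cross_all_hon : ∀ k : ℕ, ∃ c : ℝ, 0 < c ∧ ∀ (S : Set ℤ) (n : ℕ) (a b : ℤ) (w h : ℕ),
    1 ≤ n → n ≤ w → w ≤ k * n → n ≤ h → h ≤ k * n → (∀ x : ℤ, a ≤ x → x < a + w → x ∉ S) →
    c ≤ (νmix S).real (lrCross a b w h) ∧ c ≤ (νmix S).real (tbCross a b w h) := by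
  intro k
  obtain ⟨c, hc, hb⟩ := crossings_aspect_hon k
  refine ⟨c, hc, fun S n a b w h hn hnw hwk hnh hhk hS => ?_⟩
  rw [nuMix_real_lrCross, nuMix_real_tbCross]
  exact hb S a b w h (by omega) (by omega) (hwk.trans (Nat.mul_le_mul_left k hnh))
    (hhk.trans (Nat.mul_le_mul_left k hnw)) hS

end Summit.CriticalPhenomena.CardyFormulaZ2.Theorems.IKLinearTransport.PinnedDiagramExchange.FarRSWAllAspects

end
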